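import Literature.NumberTheory.EllipticCurves.TwoIsogenyTorsorImage
import Literature.NumberTheory.EllipticCurves.ShaIsogenyProofs
import Literature.NumberTheory.EllipticCurves.IsogenyDualProofs
import HarnessLib

/-!
# Route IsogenyRedei, crux `PencilSelmerDictionary` (stmt-Parity-11584), line
# `toric-node-vacuity-cassels`: stub F2a `stub_dualPairMaps` — the explicit `2`-isogeny and
# its dual

For an elliptic curve `V : y² = x³ + a₂x² + a₄x` in two-torsion normal form over a number field
`K` and `W = V.twoIsogenyCodomain : Y² = X³ − 2a₂X² + (a₂² − 4a₄)X`, we produce the pair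
`φ = V.twoIsogeny : V → W` (Silverman's explicit `2`-isogeny, tree `IsogenyTwoTorsionProofs`) and
`ψ : W → V` its dual (tree `Isogeny.exists_dual_of_isElliptic`) and prove:

* `ψ ∘ φ = [deg φ]`, `deg φ = 2` (`degree_twoIsogeny`), `φ ∘ ψ = [2]` (`φ` is onto `K̄`-points);
* `ψ` is onto `K̄`-points (`Isogeny.surjective`);
* `ker ψ = {O, T_W}`, `T_W = (0, 0)`: `ψ(φ P) = 2P = O` forces `P ∈ V[2] = {O, T_V, (r, 0)}`,
  whose images under `φ` are `O` and `T_W`; conversely `T_W = φ(r, 0)` for a root `r ∈ K̄` of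
  `x² + a₂x + a₄`, and `2 · (r, 0) = O`;
* `#ker Ш(φ) = #(Ш(V/K) ∩ im Ξ_V)` (tree `natCard_sha_inf_range_twoIsogenyTorsorHom_eq`).

Everything is proved from the tree; no definitions, no named facts.

## References

* J. H. Silverman, *The Arithmetic of Elliptic Curves*, 2nd ed., GTM 106 (2009), III.4 Example 4.5,
  Thm. III.6.1, Thm. X.4.2(a), Prop. X.4.9.
-/

noncomputable section

open scoped Classical

universe u

namespace Summit.Parity.BatemanHorn.Theorems.PencilSelmerDictionary

open Literature.NumberTheory.EllipticCurves
open _root_.WeierstrassCurve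

section Geometry

variable {K : Type u} [Field K] (V : WeierstrassCurve K) [V.IsTwoTorsionNF] [V.IsElliptic]

omit [V.IsElliptic] in
/-- A geometric point `P` of `V : y² = x³ + a₂x² + a₄x` with `2P = O` (characteristic `0`) is `O`
or an affine point `(x, 0)`: `P = -P` reads `y = -y`. Silverman, *AEC*, III.2.3. [folklore] -/
theorem eq_zero_or_eq_some_zero_of_two_zsmul_eq_zero [CharZero K] {P : V.geomPoints}
    (hP : (2 : ℤ) • P = 0) :
    P = 0 ∨ ∃ (x : AlgebraicClosure K)
      (h : (V.baseChange (AlgebraicClosure K)).toAffine.Nonsingular x 0),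
        P = Affine.Point.some x 0 h := by
  rcases P with _ | ⟨x, y, h⟩
  · exact Or.inl rfl
  · right
    have hneg : (Affine.Point.some x y h : V.geomPoints) = -Affine.Point.some x y h := by
      rwa [two_zsmul, add_eq_zero_iff_eq_neg] at hP
    have hneg' : (Affine.Point.some x y h : (V.baseChange (AlgebraicClosure K)).toAffine.Point) =
        Affine.Point.some x ((V.baseChange (AlgebraicClosure K)).toAffine.negY x y)
          ((Affine.nonsingular_neg ..).mpr h) := hneg
    rw [Affine.Point.some.injEq, negY_of_isTwoTorsionNF] at hneg'
    have hy : y = 0 := by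
      have h2 : (2 : AlgebraicClosure K) * y = 0 := by linear_combination hneg'.2
      simpa using h2
    subst hy
    exact ⟨x, h, rfl⟩

/-- The `2`-isogeny `φ` sends an affine `2`-torsion point `(x, 0)` of `V` to `O` (if `x = 0`,
i.e. the point is `T_V`) or to `T_W = (0, 0)` (if `x ≠ 0`: then `x² + a₂x + a₄ = 0`, so
`φ(x, 0) = ((x² + a₂x + a₄)/x, 0) = (0, 0)`). Silverman, *AEC*, III.4 Example 4.5. [folklore] -/
theorem twoIsogenyGeomHom_some_zero {x : AlgebraicClosure K}
    (h : (V.baseChange (AlgebraicClosure K)).toAffine.Nonsingular x 0) :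
    V.twoIsogenyGeomHom (Affine.Point.some x 0 h) = 0 ∨
      V.twoIsogenyGeomHom (Affine.Point.some x 0 h) = V.twoIsogenyCodomain.geomTwoTorsionPoint := by
  by_cases hx : x = 0
  · left
    subst hx
    exact twoIsogenyGeomHom_geomTwoTorsionPoint V
  · right
    obtain ⟨h', e⟩ := twoIsogenyGeomHom_some V h hx
    rw [e]
    have hrel := rel_of_nonsingular _ h
    have hq : x ^ 2 + (V.baseChange (AlgebraicClosure K)).a₂ * x +
        (V.baseChange (AlgebraicClosure K)).a₄ = 0 := by
      have hx3 : x * (x ^ 2 + (V.baseChange (AlgebraicClosure K)).a₂ * x +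
          (V.baseChange (AlgebraicClosure K)).a₄) = 0 := by
        linear_combination -hrel
      exact (mul_eq_zero.mp hx3).resolve_left hx
    obtain ⟨h'', e'⟩ := some_eq_some_of_eq
      (V := V.twoIsogenyCodomain.baseChange (AlgebraicClosure K)) h' (x' := 0) (y' := 0)
      (by rw [twoIsogenyX, hq, zero_div]) (by rw [twoIsogenyY, zero_mul, zero_div])
    rw [e']
    rfl

/-- `T_W = (0, 0) ∈ W(K̄)` is the image under `φ` of a `2`-torsion point `R = (r, 0)` of `V`,
`r ∈ K̄` a root of `x² + a₂x + a₄` (so `r ≠ 0` as `a₄ ≠ 0`). Silverman, *AEC*, III.4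
Example 4.5. [folklore] -/
theorem exists_twoIsogenyGeomHom_eq_geomTwoTorsionPoint [CharZero K] :
    ∃ R : V.geomPoints, V.twoIsogenyGeomHom R = V.twoIsogenyCodomain.geomTwoTorsionPoint ∧
      (2 : ℤ) • R = 0 := by
  set V' := V.baseChange (AlgebraicClosure K) with hV'
  obtain ⟨r, hr⟩ : ∃ r : AlgebraicClosure K, 1 * (r * r) + V'.a₂ * r + V'.a₄ = 0 :=
    exists_quadratic_eq_zero one_ne_zero (IsAlgClosed.exists_eq_mul_self _)
  have hq : r ^ 2 + V'.a₂ * r + V'.a₄ = 0 := by linear_combination hr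
  have hr0 : r ≠ 0 := by
    rintro rfl
    apply a₄_ne_zero V'
    linear_combination hq
  have heq : V'.toAffine.Equation r 0 := by
    rw [equation_iff_of_isTwoTorsionNF]
    linear_combination (-r) * hq
  have hns : V'.toAffine.Nonsingular r 0 := Affine.equation_iff_nonsingular.mp heq
  refine ⟨Affine.Point.some r 0 hns, ?_, ?_⟩
  · rcases twoIsogenyGeomHom_some_zero V hns with h0 | hT
    · exfalso
      have hmem : (Affine.Point.some r 0 hns : V.geomPoints) ∈ V.twoIsogenyGeomHom.ker := h0
      rcases (mem_ker_twoIsogenyGeomHom_iff V _).mp hmem with h1 | h1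
      · exact Affine.Point.some_ne_zero hns h1
      · have h2 : (Affine.Point.some r 0 hns : V'.toAffine.Point) =
            Affine.Point.some 0 0 (nonsingular_zero_zero V') := h1
        rw [Affine.Point.some.injEq] at h2
        exact hr0 h2.1
    · exact hT
  · rw [two_zsmul]
    exact Affine.Point.add_self_of_Y_eq (by rw [negY_of_isTwoTorsionNF, neg_zero])

end Geometry

/-- **Stub F2a — the explicit `2`-isogeny and its dual (geometry).** For an elliptic curve `V`
over a number field in two-torsion normal form and `W = V'` its `2`-isogenous curve (tree
`twoIsogenyCodomain`, given as an equation `hW`): there are isogenies `φ : V → W` (the tree's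
`V.twoIsogeny`) and `ψ : W → V` (its dual, tree `Isogeny.exists_dual_of_isElliptic` with
`degree_twoIsogeny`) such that `ψ ∘ φ = [deg φ] = [2]`, `φ ∘ ψ = [2]` (`φ` is onto `K̄`-points),
`ψ` is onto `K̄`-points, `ker ψ = {O, T_W}`, and `#ker Ш(φ) = #(Ш(V) ∩ im Ξ_V)` (the tree's
`natCard_sha_inf_range_twoIsogenyTorsorHom_eq`). Silverman, *AEC*, III.4.5, III.6.1, X.4.2(a).
[cite: SilvermanAEC2009, III.4 Example 4.5] -/
theorem stub_dualPairMaps {K : Type u} [Field K] [NumberField K] (V W : WeierstrassCurve K)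
    [V.IsTwoTorsionNF] [V.IsElliptic] [W.IsTwoTorsionNF] [W.IsElliptic]
    (hW : V.twoIsogenyCodomain = W) :
    ∃ (φ : V.Isogeny W) (ψ : W.Isogeny V),
      (∀ P, ψ (φ P) = (φ.degree : ℤ) • P) ∧ φ.degree = 2 ∧
        (∀ Q, φ (ψ Q) = ((2 : ℕ) : ℤ) • Q) ∧ Function.Surjective ψ ∧
          (∀ Q, ψ Q = 0 ↔ Q = 0 ∨ Q = W.geomTwoTorsionPoint) ∧
            Nat.card (shaMap φ.toAddMonoidHom φ.equivariant φ.hasLocalPointsMaps_toAddMonoidHom).ker =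
              Nat.card ↥(V.sha ⊓
                AddMonoidHom.range (G := Additive (WeierstrassCurve.Affine.SqUnits K)) V.twoIsogenyTorsorHom) := by
  subst hW
  obtain ⟨ψ, hψ⟩ := (V.twoIsogeny).exists_dual_of_isElliptic
  have hdeg : (V.twoIsogeny).degree = 2 := degree_twoIsogeny V
  have hsurjφ : Function.Surjective V.twoIsogeny := (V.twoIsogeny).surjective
  have hψ2 : ∀ P, ψ (V.twoIsogeny P) = (2 : ℤ) • P := fun P => by
    rw [hψ, hdeg]; rfl
  refine ⟨V.twoIsogeny, ψ, hψ, hdeg, fun Q => ?_, ψ.surjective, fun Q => ?_, ?_⟩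
  · obtain ⟨P, rfl⟩ := hsurjφ Q
    rw [hψ2, map_zsmul]
    rfl
  · constructor
    · intro hQ
      obtain ⟨P, rfl⟩ := hsurjφ Q
      have h2 : (2 : ℤ) • P = 0 := by rw [← hψ2, hQ]
      rcases eq_zero_or_eq_some_zero_of_two_zsmul_eq_zero V h2 with rfl | ⟨x, h, rfl⟩
      · exact Or.inl (map_zero _)
      · exact twoIsogenyGeomHom_some_zero V h
    · rintro (rfl | rfl)
      · exact map_zero _
      · obtain ⟨R, hR, h2R⟩ := exists_twoIsogenyGeomHom_eq_geomTwoTorsionPoint V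
        have hR' : V.twoIsogeny R = V.twoIsogenyCodomain.geomTwoTorsionPoint := hR
        rw [← hR', hψ2, h2R]
  · exact (natCard_sha_inf_range_twoIsogenyTorsorHom_eq V
      (V.twoIsogeny).hasLocalPointsMaps_toAddMonoidHom).symm

end Summit.Parity.BatemanHorn.Theorems.PencilSelmerDictionary

end
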